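import Literature.Computability.AlgebraicComplexity.OrbitClosureInheritance
import Literature.Computability.AlgebraicComplexity.HwvEvaluationRankBound
import Mathlib.Algebra.MvPolynomial.NoZeroDivisors
import HarnessLib

/-!
# Few-row equations of an orbit closure live on few letters

Topic `Computability/AlgebraicComplexity` (geometric complexity theory). Companion of
`OrbitClosureInheritance.lean` (Bürgisser–Landsberg–Manivel–Weyman 2011 Prop. 6.3.2): there the SMALL
polynomial `p ∈ k[x_σ]` was placed in a big space; here the BIG orbit closure `Δ_m(f)`,
`f ∈ k[x_τ]` arbitrary (e.g. `det_m` in its `m²` letters), is tested against highest-weight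
vectors of FEW-ROW types, i.e. weights of `GL_τ` vanishing off an upper set `range ι` of `|σ|`
letters (`ι : σ → τ` strictly monotone; for a partition `λ` this is `ℓ(λ) ≤ |σ|`).

* `rename_mem_orbitVanishingIdeal_iff_forall_orbitClosure` (infinite field, `f` a nonzero form of
  degree `m`): a test polynomial `F` on `Sym^m k^σ`, renamed to the big coordinate ring, is an
  EQUATION of `Δ_m(f)` iff `F` vanishes at every `p ∈ k[x_σ]` whose placement `ι p` lies in
  `Δ_m(f)` — the "`σ`-letter part" of the orbit closure. (`⇐` tests `F` at the `σ`-letter part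
  `g|^{range ι} · f` of each orbit point, a point of `End · f ⊂ Δ(f)`, `rename_killCompl_linSubst`.)
* `exists_hwv_mem_orbitVanishingIdeal_extend_iff`: `Δ_m(f)` has a highest-weight equation of the
  few-row type `χ̂` (`χ` extended by zero) iff some `GL_σ`-highest-weight vector of weight `χ` on
  `Sym^m k^σ` vanishes on the `σ`-letter part of `Δ_m(f)` — e.g. for `f = det_m` and four letters:
  a 4-row equation of `Ω_m` is the same thing as a `GL_4`-covariant of quaternary `m`-ics vanishing
  on all `det M(x_1,…,x_4)`, `M` an `m × m` matrix of linear forms (Beauville 2000 §6; Landsberg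
  2017 §6.8.2 for `m = 4`).
* `orbitMultiplicity_extend_add_finrank_eq_plethysmCoeff` (characteristic zero): the multiplicity
  of a few-row type in `k[Δ_m(f)]` is computed in the small space:
  `mult_{χ̂} k[Δ_m(f)] + dim{F ∈ HWV_χ(k[Sym^m k^σ]) : F ≡ 0 on the σ-letter part} = a_χ`.
* `orbitMultiplicity_extend_eq_plethysmCoeff_of_forall_mem_orbitClosure` (**density ⇒ fullness**):
  if EVERY form of degree `m` in the letters `σ` lies (placed by `ι`) in `Δ_m(f)`, then no few-row
  type drops: `mult_{χ̂} k[Δ_m(f)] = a_{χ̂}` for all `χ` — the mechanism behind "`Ω_m` is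
  equation-free on 3 letters" (every ternary form is a limit of linear determinants, Dickson 1921)
  and "on 4 letters for `m ≤ 3`" (Beauville 2000 Cor. 6.4), which the tree proves Summits-side for
  `det_m` with the letters hard-wired; this is the general Literature form (any `f`, any `σ`).
* §5–§6 (corollaries): under the same density hypothesis no few-row type is a MULTIPLICITY
  OBSTRUCTION against `g ∈ Δ_m(f)` for any form `g`
  (`orbitMultiplicity_le_orbitMultiplicity_extend_of_forall_mem_orbitClosure`,
  `not_isMultiplicityObstructionAt_extend_of_forall_mem_orbitClosure`); partition forms for an
  arbitrary injective placement `κ : Fin K → τ` of the few letters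
  (`orbitMultiplicity_dualOfPartition_eq_of_forall_mem_orbitClosure`, density for one placement is
  density for all, `rename_mem_orbitClosure_of_rename_mem_orbitClosure`); and the determinant
  `Ω_M = Δ_M(det_M)` in the tree's letters `MatIdx M`
  (`orbitMultiplicity_detFormLex_eq_of_forall_mem_orbitClosure`,
  `not_isMultiplicityObstructionAt_detFormLex_of_forall_mem_orbitClosure`).
* §7 (degree by degree): if the `σ`-letter part has no equation of degree `D`, every few-row
  type of degree `D` is full and is no multiplicity obstruction
  (`orbitMultiplicity_extend_eq_plethysmCoeff_of_forall_isHomogeneous_eq_zero`,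
  `orbitMultiplicity_le_orbitMultiplicity_extend_of_forall_isHomogeneous_eq_zero`); conversely a
  dropping few-row type exhibits a few-letter highest-weight equation of its degree
  (`exists_hwv_of_orbitMultiplicity_extend_lt`, `forall_orbitMultiplicity_extend_eq_iff_forall_hwv_eq_zero`)
  — the shape in which "linear determinantal quartic surfaces form a prime divisor of degree
  `320 112` in `|O_{P³}(4)|`" (Leal–Lozano Huerta–Vite 2024 Thm. 2; Landsberg 2017 Thm. 6.8.2.1
  prints the Noether–Lefschetz-weighted count `640 224 = 2 · 320 112`) prices the 4-row types of
  `k[Ω₄]`.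
* §8: the `σ`-letter part is `GL_σ`-stable (`rename_linSubstRep_mem_orbitClosure`), so a plain
  equation of degree `D` yields a highest-weight one (`exists_hwv_of_isHomogeneous_of_forall_orbitClosure`,
  Lie–Kolchin as in `HwvIdealDegreeCriterion.lean`), whence the clean biconditional
  `forall_orbitMultiplicity_extend_eq_iff_forall_isHomogeneous_eq_zero`: ALL few-row types of
  degree `D` are full in `k[Δ_m(f)]` iff the `σ`-letter part has NO equation of degree `D`.
* §9: the same biconditional in PARTITION form for an arbitrary injective placement
  `κ : Fin K → τ` (`forall_orbitMultiplicity_dualOfPartition_eq_iff_forall_isHomogeneous_eq_zero`: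
  all `λ` with `ℓ(λ) ≤ K`, `|λ| = m D` full ⇔ no `K`-letter equation of degree `D`; non-partition
  weights carry no highest-weight vector and are trivially full), and for `det_M` in the tree's
  letters (`forall_orbitMultiplicity_detFormLex_eq_iff_forall_isHomogeneous_eq_zero`,
  `not_isMultiplicityObstructionAt_detFormLex_of_forall_isHomogeneous_eq_zero`).
* §10: if the ideal of the `σ`-letter part is PRINCIPAL with generator of degree `N₀`, all few-row
  types of degree `D` are full iff `D < N₀`
  (`forall_orbitMultiplicity_extend_eq_iff_lt_of_vanishingIdeal_eq_span`) — with the printed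
  input "`I`(linear determinantal quartics) `= (Φ)`, `deg Φ = 320 112`" this says the first 4-row
  type of `k[Ω₄]` drops in degree exactly `320 112`.
* §11: the polynomial-identity test `rename_mem_orbitVanishingIdeal_iff_forall_matrix` — `F` is a
  few-row equation iff `F(kill_σ(A · f)) = 0` for EVERY matrix `A` (for `det_m`: iff `F` vanishes
  on all `det M(x_σ)`, `M` an `m × m` matrix of linear forms in the letters `σ`), and the
  agreement of the closure / endomorphism / orbit tests (`forall_orbitClosure_iff_forall_matrix`).
* §12: the cell's few-row NULL CONTROL `a_λ(M, K) ≤ sk(λ, M × d)` for `ℓ(λ) ≤ K` as a theorem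
  modulo `K`-letter density (or modulo "no `K`-letter equation of degree `d`"), combining §6/§9
  with BLMW's orbit bound `orbitMultiplicity_det_le_symKroneckerCoeffRect`
  (`plethysmCoeffOfPartition_le_symKroneckerCoeffRect_of_forall_mem_orbitClosure`,
  `plethysmCoeffOfPartition_le_symKroneckerCoeffRect_of_forall_isHomogeneous_eq_zero`).

Written for the GCT multiplicity-obstruction engine (cell `pub-gct`; filter F9 "few_rows" and the
`ℓ(λ) = 4` discussion at `m = 4, 5`). Honest framing of that cell: rung-1 multiplicity-obstruction
search for permanent versus determinant at small `(n, m)`; no claim about VP ≠ VNP or P ≠ NP.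
No definitions, no named facts.

## References

* [BurgisserEtAl2011] BLMW, SIAM J. Comput. 40(4) (2011), Prop. 6.3.2 and its proof
  (arXiv:0907.2850v3 TeX ll. 1606–1634); §4.4.
* [Beauville2000] A. Beauville, *Determinantal hypersurfaces*, Michigan Math. J. 48 (2000) =
  arXiv:math/9910030, §6 (general surfaces of degree `d ≥ 4` are not linear determinants),
  Cor. 6.4, Cor. 6.6.
* [Landsberg2017] J. M. Landsberg, *Geometry and Complexity Theory*, §6.8.2 (Thm. 6.8.2.1,
  Prop. 6.8.2.3), §8.3.3.
* [LealLozanohuertaVite2024] M. Leal, C. Lozano Huerta, M. Vite, *The Noether–Lefschetz locus of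
  surfaces in P³ formed by determinantal surfaces*, Math. Nachr. 297 (2024) 4671–4688
  (arXiv:2303.09028), Thm. 2, Lemma 4.2, §4.2 (linear determinantal quartics: prime divisor of
  degree 320 112 = ½ · NL₂₀).
-/

noncomputable section

open MvPolynomial

namespace Literature.Computability.AlgebraicComplexity

open _root_.Literature.NumberTheory.DiophantineGeometry
open _root_.Literature.Barriers.ValiantsHypothesis (degIdxMap degIdxMap_injective
  rename_mem_highestWeightSpace_coordRep killCompl_X_app killCompl_X_of_not_mem sum_eq_sum_app)

variable {k : Type*} [Field k] {σ τ : Type*} [Fintype σ] [LinearOrder σ] [Fintype τ]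
  [LinearOrder τ] {ι : σ → τ} {m : ℕ}

/-! ### §1 The `σ`-letter part of an orbit point is an endomorphism translate -/

omit [LinearOrder σ] in
/-- **Restricting a substitution to the letters of `range ι`**: killing the variables off
`range ι` in `A · f` and placing the result back gives the substitution by the matrix `A` with the
rows off `range ι` zeroed: `ι(kill(A · f)) = A^{range ι} · f`. [folklore] -/
theorem rename_killCompl_linSubst (hι : Function.Injective ι) (A : Matrix τ τ k)
    (f : MvPolynomial τ k) :
    rename ι (killCompl hι (linSubst τ k A f)) =
      linSubst τ k (Matrix.of fun x y => if x ∈ Set.range ι then A x y else 0) f := by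
  classical
  suffices h : ((rename ι).comp (killCompl hι)).comp (linSubst τ k A) =
      linSubst τ k (Matrix.of fun x y => if x ∈ Set.range ι then A x y else 0) from
    congrArg (fun φ => φ f) h
  apply MvPolynomial.algHom_ext
  intro i
  simp only [AlgHom.comp_apply, linSubst_X, map_sum, map_smul, Matrix.of_apply]
  rw [sum_eq_sum_app hι (fun x => (if x ∈ Set.range ι then A x i else 0) • (X x : MvPolynomial τ k))
    fun x hx => by rw [if_neg hx, zero_smul]]
  rw [sum_eq_sum_app hι _ fun x hx => by rw [killCompl_X_of_not_mem hι hx, map_zero, smul_zero]]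
  refine Finset.sum_congr rfl fun j _ => ?_
  rw [killCompl_X_app, rename_X, if_pos ⟨j, rfl⟩]

omit [LinearOrder σ] in
/-- Hence the `σ`-letter part of every orbit point, placed back, is a point of the orbit CLOSURE
(infinite field; `End · f ⊂ Δ(f)`). [folklore] -/
theorem rename_killCompl_linSubstRep_mem_orbitClosure [Infinite k] (hι : Function.Injective ι)
    (g : GL τ k) (f : MvPolynomial τ k) :
    rename ι (killCompl hι (linSubstRep τ k g f)) ∈ orbitClosure f := by
  rw [linSubstRep_apply, rename_killCompl_linSubst]
  exact linSubst_mem_orbitClosure f _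

/-! ### §2 Equations of few-row type are tested on the few-letter part -/

/-- **A renamed test polynomial is an equation of `Δ_m(f)` iff it vanishes on the `σ`-letter part
of `Δ_m(f)`** (`f` a nonzero form of degree `m`, infinite field): for `F` a polynomial on
`Sym^m k^σ`, `ι F ∈ I(GL_τ · f)` iff `F(p) = 0` for every `p ∈ k[x_σ]` with `ι p ∈ Δ_m(f)`.
(`⇒`: the ideal of the orbit vanishes on the closure, and `(ι F)(ι p) = F(p)`; `⇐`: at an orbit
point `g · f`, `(ι F)(g · f) = F(kill(g · f))` and `ι kill(g · f) ∈ End · f ⊂ Δ(f)`.) This is the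
reading of BLMW's proof of Prop. 6.3.2 ("`p(h) = p(h₁)`") for an arbitrary orbit closure.
[cite: BurgisserEtAl2011, Prop. 6.3.2 (proof)] -/
theorem rename_mem_orbitVanishingIdeal_iff_forall_orbitClosure [Infinite k]
    (hι : Function.Injective ι) {f : MvPolynomial τ k} (hf : f.IsHomogeneous m) (hf0 : f ≠ 0)
    (F : MvPolynomial (DegIdx σ m) k) :
    rename (degIdxMap hι) F ∈ orbitVanishingIdeal f m ↔
      ∀ p : MvPolynomial σ k, rename ι p ∈ orbitClosure f → aeval (formCoeff m p) F = 0 := by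
  constructor
  · intro h p hp
    rw [← aeval_formCoeff_rename_rename_degIdxMap hι p F]
    exact aeval_formCoeff_eq_zero_of_mem_orbitClosure hf hf0 hp h
  · intro h
    rw [mem_orbitVanishingIdeal_iff]
    intro g
    rw [aeval_formCoeff_rename_degIdxMap]
    exact h _ (rename_killCompl_linSubstRep_mem_orbitClosure hι g f)

/-- The same as an equality of submodules: the renamed polynomials lying in `I(GL_τ · f)` are the
renamings of the vanishing ideal of the `σ`-letter part
`{formCoeff m p : ι p ∈ Δ_m(f)} ⊂ Sym^m k^σ`. [cite: BurgisserEtAl2011, Prop. 6.3.2 (proof)] -/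
theorem comap_rename_orbitVanishingIdeal_eq_vanishingIdeal [Infinite k]
    (hι : Function.Injective ι) {f : MvPolynomial τ k} (hf : f.IsHomogeneous m) (hf0 : f ≠ 0) :
    (orbitVanishingIdeal f m).comap (rename (degIdxMap (m := m) hι)) =
      MvPolynomial.vanishingIdeal k (formCoeff m '' {p : MvPolynomial σ k | rename ι p ∈ orbitClosure f}) := by
  ext F
  rw [Ideal.mem_comap, MvPolynomial.mem_vanishingIdeal_iff, Set.forall_mem_image]
  exact rename_mem_orbitVanishingIdeal_iff_forall_orbitClosure hι hf hf0 F

/-! ### §3 Highest-weight equations of few-row type -/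

/-- **The highest-weight equations of few-row type, as a space**: for `ι` strictly monotone onto an
upper set, the highest-weight vectors of `k[Sym^m k^τ]` of weight `χ` extended by zero that vanish
on `GL_τ · f` are exactly the renamings of the `GL_σ`-highest-weight vectors of weight `χ` on
`Sym^m k^σ` vanishing on the `σ`-letter part of `Δ_m(f)`.
[cite: BurgisserEtAl2011, Prop. 6.3.2 (proof)] -/
theorem highestWeightSpace_extend_inf_orbitVanishingIdeal_eq_map [Infinite k] (hι : StrictMono ι)
    (hup : IsUpperSet (Set.range ι)) {f : MvPolynomial τ k} (hf : f.IsHomogeneous m) (hf0 : f ≠ 0)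
    (χ : Weight σ) :
    highestWeightSpace (coordRep τ k m) (Function.extend ι χ 0) ⊓
        (orbitVanishingIdeal f m).restrictScalars k =
      (highestWeightSpace (coordRep σ k m) χ ⊓
        (MvPolynomial.vanishingIdeal k
          (formCoeff m '' {p : MvPolynomial σ k | rename ι p ∈ orbitClosure f})).restrictScalars k).map
        (rename (degIdxMap hι.injective) :
          MvPolynomial (DegIdx σ m) k →ₐ[k] MvPolynomial (DegIdx τ m) k).toLinearMap := by
  rw [← comap_rename_orbitVanishingIdeal_eq_vanishingIdeal hι.injective hf hf0]
  apply le_antisymm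
  · intro G hG
    obtain ⟨hG1, hG2⟩ := Submodule.mem_inf.mp hG
    rw [highestWeightSpace_extend_eq_map hι hup χ] at hG1
    obtain ⟨F, hF, rfl⟩ := Submodule.mem_map.mp hG1
    refine Submodule.mem_map.mpr ⟨F, Submodule.mem_inf.mpr ⟨hF, ?_⟩, rfl⟩
    rw [Submodule.restrictScalars_mem] at hG2 ⊢
    exact Ideal.mem_comap.mpr hG2
  · intro G hG
    obtain ⟨F, hF, rfl⟩ := Submodule.mem_map.mp hG
    obtain ⟨hF1, hF2⟩ := Submodule.mem_inf.mp hF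
    refine Submodule.mem_inf.mpr ⟨rename_mem_highestWeightSpace_coordRep hι hup hF1, ?_⟩
    rw [Submodule.restrictScalars_mem] at hF2
    rw [AlgHom.toLinearMap_apply, Submodule.restrictScalars_mem]
    exact Ideal.mem_comap.mp hF2

/-- **A few-row highest-weight equation of `Δ_m(f)` is a `GL_σ`-highest-weight polynomial on the
few letters vanishing on the few-letter part** (and conversely): existence form. For `f = det_m`
and four letters this says that a 4-row equation of `Ω_m` is a `GL_4`-highest-weight polynomial
on quaternary `m`-ics vanishing on all (limits of) linear determinants `det M(x_1, …, x_4)` —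
nonexistent for `m ≤ 3` (every quaternary cubic is determinantal, Beauville 2000 Cor. 6.4),
existent for `m ≥ 4` (a general quaternary `m`-ic is not, Beauville 2000 §6).
[cite: BurgisserEtAl2011, Prop. 6.3.2 (proof)] -/
theorem exists_hwv_mem_orbitVanishingIdeal_extend_iff [Infinite k] (hι : StrictMono ι)
    (hup : IsUpperSet (Set.range ι)) {f : MvPolynomial τ k} (hf : f.IsHomogeneous m) (hf0 : f ≠ 0)
    (χ : Weight σ) :
    (∃ G ∈ highestWeightSpace (coordRep τ k m) (Function.extend ι χ 0),
        G ≠ 0 ∧ G ∈ orbitVanishingIdeal f m) ↔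
      ∃ F ∈ highestWeightSpace (coordRep σ k m) χ, F ≠ 0 ∧
        ∀ p : MvPolynomial σ k, rename ι p ∈ orbitClosure f → aeval (formCoeff m p) F = 0 := by
  constructor
  · rintro ⟨G, hG, hG0, hGI⟩
    rw [highestWeightSpace_extend_eq_map hι hup χ] at hG
    obtain ⟨F, hF, rfl⟩ := Submodule.mem_map.mp hG
    refine ⟨F, hF, fun h => hG0 (by rw [h]; exact map_zero _), ?_⟩
    exact (rename_mem_orbitVanishingIdeal_iff_forall_orbitClosure hι.injective hf hf0 F).mp hGI
  · rintro ⟨F, hF, hF0, hFv⟩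
    refine ⟨rename (degIdxMap hι.injective) F, rename_mem_highestWeightSpace_coordRep hι hup hF,
      fun h => hF0 (rename_injective _ (degIdxMap_injective hι.injective) (by rw [h, map_zero])),
      (rename_mem_orbitVanishingIdeal_iff_forall_orbitClosure hι.injective hf hf0 F).mpr hFv⟩

/-- **The multiplicity of a few-row type is computed on the few letters** (characteristic zero,
`m ≠ 0`, `f` a nonzero form of degree `m`, `ι` strictly monotone onto an upper set):
`mult_{χ̂} k[Δ_m(f)] + dim_k (HWV_χ(k[Sym^m k^σ]) ∩ I(σ-letter part of Δ_m(f))) = a_χ`, where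
`a_χ = plethysmCoeff k σ m χ` is the SMALL plethysm coefficient. [cite: BurgisserEtAl2011, Prop. 6.3.2] -/
theorem orbitMultiplicity_extend_add_finrank_eq_plethysmCoeff [CharZero k] (hι : StrictMono ι)
    (hup : IsUpperSet (Set.range ι)) {f : MvPolynomial τ k} (hf : f.IsHomogeneous m) (hf0 : f ≠ 0)
    (hm : m ≠ 0) (χ : Weight σ) :
    orbitMultiplicity k f m (Function.extend ι χ 0) +
        Module.finrank k ↥(highestWeightSpace (coordRep σ k m) χ ⊓
          (MvPolynomial.vanishingIdeal k
            (formCoeff m '' {p : MvPolynomial σ k | rename ι p ∈ orbitClosure f})).restrictScalars k) =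
      plethysmCoeff k σ m χ := by
  haveI : Infinite k := CharZero.infinite k
  have h1 := orbitMultiplicity_add_finrank_inf_eq_plethysmCoeff f hm (Function.extend ι χ 0)
  rw [plethysmCoeff_extend hι hup, highestWeightSpace_extend_inf_orbitVanishingIdeal_eq_map hι hup hf hf0,
    (Submodule.equivMapOfInjective _
      (rename_injective _ (degIdxMap_injective hι.injective)) _).finrank_eq.symm] at h1
  exact h1

/-! ### §4 Density on few letters forces fullness of few-row types -/

omit [Fintype τ] [LinearOrder τ] in
/-- Every point of `Sym^m k^σ` is the coefficient vector of the form `∑_d c_d x^d` (which is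
homogeneous of degree `m`). [folklore] -/
theorem exists_isHomogeneous_formCoeff_eq (c : DegIdx σ m → k) :
    ∃ p : MvPolynomial σ k, p.IsHomogeneous m ∧ formCoeff m p = c := by
  classical
  refine ⟨∑ d : DegIdx σ m, c d • monomial d.1 (1 : k), ?_, ?_⟩
  · refine IsHomogeneous.sum _ _ _ fun d _ => ?_
    have h := (isHomogeneous_C σ (c d)).mul
      (isHomogeneous_monomial (R := k) (d := d.1) (n := m) 1 (mem_degMonomials_iff.mp d.2))
    rwa [zero_add, ← smul_eq_C_mul] at h
  · funext d
    rw [formCoeff_apply, coeff_sum]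
    simp only [coeff_smul, coeff_monomial, smul_eq_mul, mul_ite, mul_one, mul_zero]
    rw [Finset.sum_eq_single d]
    · simp
    · intro e _ hed
      rw [if_neg (fun h => hed (Subtype.ext h))]
    · intro h
      exact absurd (Finset.mem_univ d) h

/-- **Density ⇒ fullness (the few-letter principle).** Let `f` be a nonzero form of degree
`m ≠ 0` (characteristic zero) and `ι : σ → τ` strictly monotone onto an upper set. If EVERY form
of degree `m` in the letters `σ`, placed by `ι`, lies in the orbit closure `Δ_m(f)`, then every
weight `χ` of `GL_σ` extended by zero is FULL in `k[Δ_m(f)]`: `mult_{χ̂} k[Δ_m(f)] = a_χ` (no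
highest-weight equation of a few-row type: such an equation would be a nonzero polynomial on
`Sym^m k^σ` vanishing everywhere). This is the mechanism of "`Ω_m` is equation-free on three
letters" (every ternary `m`-ic is a limit of linear determinants) and "on four letters for
`m ≤ 3`". [cite: BurgisserEtAl2011, Prop. 6.3.2] -/
theorem orbitMultiplicity_extend_eq_plethysmCoeff_of_forall_mem_orbitClosure [CharZero k]
    (hι : StrictMono ι) (hup : IsUpperSet (Set.range ι)) {f : MvPolynomial τ k}
    (hf : f.IsHomogeneous m) (hf0 : f ≠ 0) (hm : m ≠ 0)
    (hall : ∀ p : MvPolynomial σ k, p.IsHomogeneous m → rename ι p ∈ orbitClosure f)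
    (χ : Weight σ) :
    orbitMultiplicity k f m (Function.extend ι χ 0) = plethysmCoeff k σ m χ := by
  haveI : Infinite k := CharZero.infinite k
  have h := orbitMultiplicity_extend_add_finrank_eq_plethysmCoeff hι hup hf hf0 hm χ
  suffices hbot : highestWeightSpace (coordRep σ k m) χ ⊓
      (MvPolynomial.vanishingIdeal k
        (formCoeff m '' {p : MvPolynomial σ k | rename ι p ∈ orbitClosure f})).restrictScalars k = ⊥ by
    rw [hbot, finrank_bot, add_zero] at h
    exact h
  rw [Submodule.eq_bot_iff]
  intro F hF
  obtain ⟨-, hF2⟩ := Submodule.mem_inf.mp hF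
  rw [Submodule.restrictScalars_mem, MvPolynomial.mem_vanishingIdeal_iff] at hF2
  apply MvPolynomial.funext
  intro c
  obtain ⟨p, hp, hpc⟩ := exists_isHomogeneous_formCoeff_eq c
  rw [map_zero, ← hpc]
  exact hF2 _ (Set.mem_image_of_mem _ (hall p hp))

/-- The same with the big plethysm coefficient on the right (`a_{χ̂} = a_χ`,
`plethysmCoeff_extend`), i.e. literally "no type `χ̂` drops". [cite: BurgisserEtAl2011, Prop. 6.3.2] -/
theorem orbitMultiplicity_extend_eq_plethysmCoeff_extend_of_forall_mem_orbitClosure [CharZero k]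
    (hι : StrictMono ι) (hup : IsUpperSet (Set.range ι)) {f : MvPolynomial τ k}
    (hf : f.IsHomogeneous m) (hf0 : f ≠ 0) (hm : m ≠ 0)
    (hall : ∀ p : MvPolynomial σ k, p.IsHomogeneous m → rename ι p ∈ orbitClosure f)
    (χ : Weight σ) :
    orbitMultiplicity k f m (Function.extend ι χ 0) = plethysmCoeff k τ m (Function.extend ι χ 0) := by
  haveI : Infinite k := CharZero.infinite k
  rw [plethysmCoeff_extend hι hup,
    orbitMultiplicity_extend_eq_plethysmCoeff_of_forall_mem_orbitClosure hι hup hf hf0 hm hall]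

/-- **Density ⇒ no few-row equations at all**: under the same density hypothesis (an infinite
field suffices here), every highest-weight vector `G ∈ HWV_{χ̂}(k[Sym^m k^τ])` of an extended
weight `χ̂ = extend ι χ 0` lying in `I(GL_τ · f)` is zero — `Δ_m(f)` has no highest-weight
equation of few-row type. [cite: BurgisserEtAl2011, Prop. 6.3.2] -/
theorem eq_zero_of_mem_highestWeightSpace_extend_of_mem_orbitVanishingIdeal [Infinite k]
    (hι : StrictMono ι) (hup : IsUpperSet (Set.range ι)) {f : MvPolynomial τ k}
    (hf : f.IsHomogeneous m) (hf0 : f ≠ 0)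
    (hall : ∀ p : MvPolynomial σ k, p.IsHomogeneous m → rename ι p ∈ orbitClosure f)
    {χ : Weight σ} {G : MvPolynomial (DegIdx τ m) k}
    (hG : G ∈ highestWeightSpace (coordRep τ k m) (Function.extend ι χ 0))
    (hGI : G ∈ orbitVanishingIdeal f m) : G = 0 := by
  by_contra hG0
  obtain ⟨F, -, hF0, hFv⟩ := (exists_hwv_mem_orbitVanishingIdeal_extend_iff hι hup hf hf0 χ).mp
    ⟨G, hG, hG0, hGI⟩
  apply hF0
  apply MvPolynomial.funext
  intro c
  obtain ⟨p, hp, hpc⟩ := exists_isHomogeneous_formCoeff_eq c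
  rw [map_zero, ← hpc]
  exact hFv p (hall p hp)

/-! ### §5 No multiplicity obstruction of few-row type; partition form -/

/-- **Density ⇒ no multiplicity obstruction of few-row type.** Under the density hypothesis for
`f` on the letters `σ`, every other form `g` in the letters `τ` has
`mult_{χ̂} k[Δ_m(g)] ≤ a_{χ̂} = mult_{χ̂} k[Δ_m(f)]`: comparing multiplicities at a few-row type can
never exhibit `g ∉ Δ_m(f)`. [cite: BurgisserEtAl2011, Prop. 6.3.2; §4.4] -/
theorem orbitMultiplicity_le_orbitMultiplicity_extend_of_forall_mem_orbitClosure [CharZero k]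
    (hι : StrictMono ι) (hup : IsUpperSet (Set.range ι)) {f : MvPolynomial τ k}
    (hf : f.IsHomogeneous m) (hf0 : f ≠ 0) (hm : m ≠ 0)
    (hall : ∀ p : MvPolynomial σ k, p.IsHomogeneous m → rename ι p ∈ orbitClosure f)
    (g : MvPolynomial τ k) (χ : Weight σ) :
    orbitMultiplicity k g m (Function.extend ι χ 0) ≤
      orbitMultiplicity k f m (Function.extend ι χ 0) := by
  rw [orbitMultiplicity_extend_eq_plethysmCoeff_extend_of_forall_mem_orbitClosure hι hup hf hf0 hm
    hall χ]
  have h := orbitMultiplicity_add_finrank_inf_eq_plethysmCoeff g hm (Function.extend ι χ 0)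
  omega

omit [LinearOrder σ] in
/-- Density for ONE placement of the few letters is density for every placement: two injective
placements `κ, ι : σ → τ` of `p` are conjugate under a permutation matrix
(`rename_mem_glOrbit_rename`), and orbit closures are `GL_τ`-stable and transitive. [folklore] -/
theorem rename_mem_orbitClosure_of_rename_mem_orbitClosure (κ ι : σ → τ)
    (hκ : Function.Injective κ) (hι : Function.Injective ι) {f : MvPolynomial τ k}
    {p : MvPolynomial σ k} (h : rename κ p ∈ orbitClosure f) : rename ι p ∈ orbitClosure f :=
  orbitClosure_subset_of_mem_holds h
    (glOrbit_subset_orbitClosure _ (rename_mem_glOrbit_rename ι κ hι hκ p))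

/-- **Density ⇒ fullness, partition form, any placement.** Let `τ ≃o Fin N` (`e`), let
`κ : Fin K → τ` be ANY injective placement of `K` letters, and suppose every `K`-ary form of
degree `m` placed by `κ` lies in `Δ_m(f)`. Then for every partition `λ` with `ℓ(λ) ≤ K` the type
`λ^*` is full in `k[Δ_m(f)]`, with the SMALL plethysm coefficient `a_λ(m, K)` as its multiplicity.
[cite: BurgisserEtAl2011, Prop. 6.3.2] -/
theorem orbitMultiplicity_dualOfPartition_eq_of_forall_mem_orbitClosure [CharZero k] {K N : ℕ}
    (e : Fin N ≃o τ) (κ : Fin K → τ) (hκ : Function.Injective κ) {f : MvPolynomial τ k}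
    (hf : f.IsHomogeneous m) (hf0 : f ≠ 0) (hm : m ≠ 0)
    (hall : ∀ p : MvPolynomial (Fin K) k, p.IsHomogeneous m → rename κ p ∈ orbitClosure f)
    {n : ℕ} (lam : Nat.Partition n) (hlam : lam.parts.card ≤ K) :
    orbitMultiplicity k f m (fun x => Weight.dualOfPartition N lam (e.symm x)) =
      plethysmCoeffOfPartition k K m lam := by
  have hKN : K ≤ N := by
    have := Fintype.card_le_of_injective κ hκ
    rwa [Fintype.card_fin, ← Fintype.card_congr e.toEquiv, Fintype.card_fin] at this
  rw [dualOfPartition_comp_symm_eq_extend e hKN lam hlam]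
  exact orbitMultiplicity_extend_eq_plethysmCoeff_of_forall_mem_orbitClosure
    (strictMono_comp_topEmb e hKN).1 (strictMono_comp_topEmb e hKN).2 hf hf0 hm
    (fun p hp => rename_mem_orbitClosure_of_rename_mem_orbitClosure κ _ hκ
      (strictMono_comp_topEmb e hKN).1.injective (hall p hp)) _

/-- The same with the BIG plethysm coefficient `a_λ(m, N)` (`= a_λ(m, K)` for `ℓ(λ) ≤ K ≤ N`,
`plethysmCoeffOfPartition_eq_of_card_parts_le`). [cite: BurgisserEtAl2011, Prop. 6.3.2] -/
theorem orbitMultiplicity_dualOfPartition_eq_of_forall_mem_orbitClosure' [CharZero k] {K N : ℕ}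
    (e : Fin N ≃o τ) (κ : Fin K → τ) (hκ : Function.Injective κ) {f : MvPolynomial τ k}
    (hf : f.IsHomogeneous m) (hf0 : f ≠ 0) (hm : m ≠ 0)
    (hall : ∀ p : MvPolynomial (Fin K) k, p.IsHomogeneous m → rename κ p ∈ orbitClosure f)
    {n : ℕ} (lam : Nat.Partition n) (hlam : lam.parts.card ≤ K) :
    orbitMultiplicity k f m (fun x => Weight.dualOfPartition N lam (e.symm x)) =
      plethysmCoeffOfPartition k N m lam := by
  haveI : Infinite k := CharZero.infinite k
  have hKN : K ≤ N := by
    have := Fintype.card_le_of_injective κ hκ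
    rwa [Fintype.card_fin, ← Fintype.card_congr e.toEquiv, Fintype.card_fin] at this
  rw [plethysmCoeffOfPartition_eq_of_card_parts_le hKN m lam hlam]
  exact orbitMultiplicity_dualOfPartition_eq_of_forall_mem_orbitClosure e κ hκ hf hf0 hm hall lam hlam

/-- **No multiplicity obstruction of few-row type, partition form, any placement**: under the
density hypothesis for `f` on `K` letters, `mult_{λ^*} k[Δ_m(g)] ≤ mult_{λ^*} k[Δ_m(f)]` for every
form `g` and every `λ` with `ℓ(λ) ≤ K`. [cite: BurgisserEtAl2011, Prop. 6.3.2; §4.4] -/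
theorem orbitMultiplicity_dualOfPartition_le_of_forall_mem_orbitClosure [CharZero k] {K N : ℕ}
    (e : Fin N ≃o τ) (κ : Fin K → τ) (hκ : Function.Injective κ) {f : MvPolynomial τ k}
    (hf : f.IsHomogeneous m) (hf0 : f ≠ 0) (hm : m ≠ 0)
    (hall : ∀ p : MvPolynomial (Fin K) k, p.IsHomogeneous m → rename κ p ∈ orbitClosure f)
    (g : MvPolynomial τ k) {n : ℕ} (lam : Nat.Partition n) (hlam : lam.parts.card ≤ K) :
    orbitMultiplicity k g m (fun x => Weight.dualOfPartition N lam (e.symm x)) ≤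
      orbitMultiplicity k f m (fun x => Weight.dualOfPartition N lam (e.symm x)) := by
  have hKN : K ≤ N := by
    have := Fintype.card_le_of_injective κ hκ
    rwa [Fintype.card_fin, ← Fintype.card_congr e.toEquiv, Fintype.card_fin] at this
  rw [dualOfPartition_comp_symm_eq_extend e hKN lam hlam]
  exact orbitMultiplicity_le_orbitMultiplicity_extend_of_forall_mem_orbitClosure
    (strictMono_comp_topEmb e hKN).1 (strictMono_comp_topEmb e hKN).2 hf hf0 hm
    (fun p hp => rename_mem_orbitClosure_of_rename_mem_orbitClosure κ _ hκ
      (strictMono_comp_topEmb e hKN).1.injective (hall p hp)) g _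


/-! ### §6 Obstruction typology and the determinant (ground field and letters in `Type`,
matching `ObstructionTypes.lean`) -/

section Typology

variable {k₀ : Type} [Field k₀] [CharZero k₀] {σ₀ τ₀ : Type} [Fintype σ₀] [LinearOrder σ₀]
  [Fintype τ₀] [LinearOrder τ₀] {ι₀ : σ₀ → τ₀}

/-- In the numeric typology of `ObstructionTypes.lean`: under the density hypothesis for `f` on
the letters `σ₀`, no few-row type `χ̂` is a multiplicity obstruction against `g ∈ Δ_m(f)`, for any
form `g`. [cite: BurgisserEtAl2011, Prop. 6.3.2; §4.4] -/
theorem not_isMultiplicityObstructionAt_extend_of_forall_mem_orbitClosure (hι : StrictMono ι₀)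
    (hup : IsUpperSet (Set.range ι₀)) {f : MvPolynomial τ₀ k₀} (hf : f.IsHomogeneous m)
    (hf0 : f ≠ 0) (hm : m ≠ 0)
    (hall : ∀ p : MvPolynomial σ₀ k₀, p.IsHomogeneous m → rename ι₀ p ∈ orbitClosure f)
    (g : MvPolynomial τ₀ k₀) (χ : Weight σ₀) :
    ¬ IsMultiplicityObstructionAt f g m (Function.extend ι₀ χ 0) :=
  not_lt.mpr (orbitMultiplicity_le_orbitMultiplicity_extend_of_forall_mem_orbitClosure hι hup hf
    hf0 hm hall g χ)

/-- **Few-letter density for `det_M` ⇒ fullness of few-row types in `k[Ω_M]`.** If every `K`-ary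
form of degree `M`, placed on any `K` of the `M²` matrix entries (`κ` injective), lies in
`Ω_M = Δ_M(det_M)`, then for every `λ` with `ℓ(λ) ≤ K`:
`mult_{λ^*} k[Ω_M] = a_λ(M, K)` (`= a_λ(M, M²)`, `plethysmCoeffOfPartition_eq_of_card_parts_le`).
Known inputs making the hypothesis true: `K ≤ 3`, all `M` (every ternary form is a limit of
linear determinants, Dickson 1921); `K = 4`, `M ≤ 3` (Beauville 2000 Cor. 6.4); it is false for
`K = 4`, `M ≥ 4` (Beauville 2000 §6) — these inputs are proved Summits-side for the tree's
determinant, not here. [cite: BurgisserEtAl2011, Prop. 6.3.2] -/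
theorem orbitMultiplicity_detFormLex_eq_of_forall_mem_orbitClosure {M K : ℕ}
    (κ : Fin K → MatIdx M) (hκ : Function.Injective κ) (hM : M ≠ 0)
    (hall : ∀ p : MvPolynomial (Fin K) k₀, p.IsHomogeneous M →
      rename κ p ∈ orbitClosure (detFormLex k₀ M))
    {n : ℕ} (lam : Nat.Partition n) (hlam : lam.parts.card ≤ K) :
    orbitMultiplicity k₀ (detFormLex k₀ M) M (Weight.dualOfPartition (M * M) lam).toMatIdx =
      plethysmCoeffOfPartition k₀ K M lam :=
  orbitMultiplicity_dualOfPartition_eq_of_forall_mem_orbitClosure (matIdxEquiv M) κ hκ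
    (detFormLex_isHomogeneous k₀ M) (Literature.Computability.Complexity.detFormLex_ne_zero M) hM
    hall lam hlam

/-- **… hence no multiplicity obstruction of few-row type against `g ∈ Ω_M`** for ANY form `g`
on the `M × M` matrix entries (e.g. the padded permanent `X₀₀^{M-n} per_n`): for `ℓ(λ) ≤ K`,
`mult_{λ^*} k[Δ_M(g)] ≤ mult_{λ^*} k[Ω_M]`, i.e. `¬ IsMultiplicityObstructionAt det_M g M λ^*`.
This is the general form of the GCT cell's filter F9 ("few rows carry no obstruction").
[cite: BurgisserEtAl2011, Prop. 6.3.2; §4.4] -/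
theorem not_isMultiplicityObstructionAt_detFormLex_of_forall_mem_orbitClosure {M K : ℕ}
    (κ : Fin K → MatIdx M) (hκ : Function.Injective κ) (hM : M ≠ 0)
    (hall : ∀ p : MvPolynomial (Fin K) k₀, p.IsHomogeneous M →
      rename κ p ∈ orbitClosure (detFormLex k₀ M))
    (g : MvPolynomial (MatIdx M) k₀) {n : ℕ} (lam : Nat.Partition n)
    (hlam : lam.parts.card ≤ K) :
    ¬ IsMultiplicityObstructionAt (detFormLex k₀ M) g M
      (Weight.dualOfPartition (M * M) lam).toMatIdx :=
  not_lt.mpr (orbitMultiplicity_dualOfPartition_le_of_forall_mem_orbitClosure (matIdxEquiv M) κ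
    hκ (detFormLex_isHomogeneous k₀ M) (Literature.Computability.Complexity.detFormLex_ne_zero M)
    hM hall g lam hlam)

end Typology

/-! ### §7 Degree by degree: no few-letter equation in degree `D` ⇒ few-row types of degree `D`
are full -/

/-- **Degree-wise few-letter principle.** Let `f` be a nonzero form of degree `m ≠ 0`
(characteristic zero), `ι : σ → τ` strictly monotone onto an upper set, and `D : ℕ`. If the
`σ`-letter part `{p ∈ k[x_σ] : ι p ∈ Δ_m(f)}` has NO equation of degree `D` — every form of
degree `D` on `Sym^m k^σ` vanishing on it is zero — then every few-row type `χ̂` of degree `D`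
(`|χ| = -m D`) is full: `mult_{χ̂} k[Δ_m(f)] = a_χ`. (A highest-weight equation of type `χ̂` would
be, by §3, a nonzero form of degree `D` on `Sym^m k^σ` vanishing on the `σ`-letter part; the
weight pins the degree, `isHomogeneous_of_mem_highestWeightSpace`.) Use: when the `σ`-letter
part is a hypersurface whose ideal is generated in one degree `N₀` (e.g. the linear determinantal
quartic surfaces in `P(Sym⁴ ℂ⁴)`, a prime divisor of degree `N₀ = 320 112`, Leal–Lozano
Huerta–Vite 2024 Thm. 2 — Landsberg 2017 Thm. 6.8.2.1 prints the Noether–Lefschetz-weighted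
count `640 224 = 2 N₀`), all few-row types of degree `D < N₀` are full.
[cite: BurgisserEtAl2011, Prop. 6.3.2; §4.4] -/
theorem orbitMultiplicity_extend_eq_plethysmCoeff_of_forall_isHomogeneous_eq_zero [CharZero k]
    (hι : StrictMono ι) (hup : IsUpperSet (Set.range ι)) {f : MvPolynomial τ k}
    (hf : f.IsHomogeneous m) (hf0 : f ≠ 0) (hm : m ≠ 0) {D : ℕ}
    (hD : ∀ F : MvPolynomial (DegIdx σ m) k, F.IsHomogeneous D →
      (∀ p : MvPolynomial σ k, rename ι p ∈ orbitClosure f → aeval (formCoeff m p) F = 0) → F = 0)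
    (χ : Weight σ) (hχ : χ.size = -((m * D : ℕ) : ℤ)) :
    orbitMultiplicity k f m (Function.extend ι χ 0) = plethysmCoeff k σ m χ := by
  haveI : Infinite k := CharZero.infinite k
  have h := orbitMultiplicity_extend_add_finrank_eq_plethysmCoeff hι hup hf hf0 hm χ
  suffices hbot : highestWeightSpace (coordRep σ k m) χ ⊓
      (MvPolynomial.vanishingIdeal k
        (formCoeff m '' {p : MvPolynomial σ k | rename ι p ∈ orbitClosure f})).restrictScalars k =
      ⊥ by
    rw [hbot, finrank_bot, add_zero] at h
    exact h
  rw [Submodule.eq_bot_iff]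
  intro F hF
  obtain ⟨hF1, hF2⟩ := Submodule.mem_inf.mp hF
  rw [Submodule.restrictScalars_mem, MvPolynomial.mem_vanishingIdeal_iff, Set.forall_mem_image] at hF2
  exact hD F (isHomogeneous_of_mem_highestWeightSpace hm hF1 hχ) fun p hp => hF2 hp

/-- The same with the big plethysm coefficient `a_{χ̂}` on the right.
[cite: BurgisserEtAl2011, Prop. 6.3.2; §4.4] -/
theorem orbitMultiplicity_extend_eq_plethysmCoeff_extend_of_forall_isHomogeneous_eq_zero
    [CharZero k] (hι : StrictMono ι) (hup : IsUpperSet (Set.range ι)) {f : MvPolynomial τ k}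
    (hf : f.IsHomogeneous m) (hf0 : f ≠ 0) (hm : m ≠ 0) {D : ℕ}
    (hD : ∀ F : MvPolynomial (DegIdx σ m) k, F.IsHomogeneous D →
      (∀ p : MvPolynomial σ k, rename ι p ∈ orbitClosure f → aeval (formCoeff m p) F = 0) → F = 0)
    (χ : Weight σ) (hχ : χ.size = -((m * D : ℕ) : ℤ)) :
    orbitMultiplicity k f m (Function.extend ι χ 0) =
      plethysmCoeff k τ m (Function.extend ι χ 0) := by
  haveI : Infinite k := CharZero.infinite k
  rw [plethysmCoeff_extend hι hup,
    orbitMultiplicity_extend_eq_plethysmCoeff_of_forall_isHomogeneous_eq_zero hι hup hf hf0 hm hD χ hχ]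

/-- **… and no few-row type of degree `D` is a multiplicity obstruction** against `g ∈ Δ_m(f)`,
for any form `g`: `mult_{χ̂} k[Δ_m(g)] ≤ mult_{χ̂} k[Δ_m(f)]`.
[cite: BurgisserEtAl2011, Prop. 6.3.2; §4.4] -/
theorem orbitMultiplicity_le_orbitMultiplicity_extend_of_forall_isHomogeneous_eq_zero [CharZero k]
    (hι : StrictMono ι) (hup : IsUpperSet (Set.range ι)) {f : MvPolynomial τ k}
    (hf : f.IsHomogeneous m) (hf0 : f ≠ 0) (hm : m ≠ 0) {D : ℕ}
    (hD : ∀ F : MvPolynomial (DegIdx σ m) k, F.IsHomogeneous D →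
      (∀ p : MvPolynomial σ k, rename ι p ∈ orbitClosure f → aeval (formCoeff m p) F = 0) → F = 0)
    (g : MvPolynomial τ k) (χ : Weight σ) (hχ : χ.size = -((m * D : ℕ) : ℤ)) :
    orbitMultiplicity k g m (Function.extend ι χ 0) ≤
      orbitMultiplicity k f m (Function.extend ι χ 0) := by
  rw [orbitMultiplicity_extend_eq_plethysmCoeff_extend_of_forall_isHomogeneous_eq_zero hι hup hf
    hf0 hm hD χ hχ]
  have h := orbitMultiplicity_add_finrank_inf_eq_plethysmCoeff g hm (Function.extend ι χ 0)
  omega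


/-- Conversely, **a few-row type that drops exhibits a few-letter highest-weight equation of its
degree**: if `mult_{χ̂} k[Δ_m(f)] < a_χ` with `|χ| = -m D`, then some nonzero `GL_σ`-highest-weight
vector of weight `χ` on `Sym^m k^σ` — a form of degree `D` — vanishes on the `σ`-letter part of
`Δ_m(f)` (rank–nullity, §3). [cite: BurgisserEtAl2011, Prop. 6.3.2; §4.4] -/
theorem exists_hwv_of_orbitMultiplicity_extend_lt [CharZero k] (hι : StrictMono ι)
    (hup : IsUpperSet (Set.range ι)) {f : MvPolynomial τ k} (hf : f.IsHomogeneous m)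
    (hf0 : f ≠ 0) (hm : m ≠ 0) (χ : Weight σ) {D : ℕ} (hχ : χ.size = -((m * D : ℕ) : ℤ))
    (hlt : orbitMultiplicity k f m (Function.extend ι χ 0) < plethysmCoeff k σ m χ) :
    ∃ F ∈ highestWeightSpace (coordRep σ k m) χ, F ≠ 0 ∧ F.IsHomogeneous D ∧
      ∀ p : MvPolynomial σ k, rename ι p ∈ orbitClosure f → aeval (formCoeff m p) F = 0 := by
  haveI : Infinite k := CharZero.infinite k
  have h := orbitMultiplicity_extend_add_finrank_eq_plethysmCoeff hι hup hf hf0 hm χ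
  have hS : highestWeightSpace (coordRep σ k m) χ ⊓
      (MvPolynomial.vanishingIdeal k
        (formCoeff m '' {p : MvPolynomial σ k | rename ι p ∈ orbitClosure f})).restrictScalars k ≠
      ⊥ := by
    intro hb
    rw [hb, finrank_bot, add_zero] at h
    exact (ne_of_lt hlt) h
  obtain ⟨F, hF, hF0⟩ := (Submodule.ne_bot_iff _).mp hS
  obtain ⟨hF1, hF2⟩ := Submodule.mem_inf.mp hF
  rw [Submodule.restrictScalars_mem, MvPolynomial.mem_vanishingIdeal_iff, Set.forall_mem_image] at hF2
  exact ⟨F, hF1, hF0, isHomogeneous_of_mem_highestWeightSpace hm hF1 hχ, fun p hp => hF2 hp⟩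

/-- Hence, degree by degree, **the few-row types of degree `D` are all full iff the `σ`-letter
part has no highest-weight equation of degree `D`** (for weights `χ` of `GL_σ` with `|χ| = -m D`).
[cite: BurgisserEtAl2011, Prop. 6.3.2; §4.4] -/
theorem forall_orbitMultiplicity_extend_eq_iff_forall_hwv_eq_zero [CharZero k] (hι : StrictMono ι)
    (hup : IsUpperSet (Set.range ι)) {f : MvPolynomial τ k} (hf : f.IsHomogeneous m)
    (hf0 : f ≠ 0) (hm : m ≠ 0) (D : ℕ) :
    (∀ χ : Weight σ, χ.size = -((m * D : ℕ) : ℤ) →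
        orbitMultiplicity k f m (Function.extend ι χ 0) = plethysmCoeff k σ m χ) ↔
      ∀ χ : Weight σ, χ.size = -((m * D : ℕ) : ℤ) →
        ∀ F ∈ highestWeightSpace (coordRep σ k m) χ,
          (∀ p : MvPolynomial σ k, rename ι p ∈ orbitClosure f → aeval (formCoeff m p) F = 0) →
            F = 0 := by
  haveI : Infinite k := CharZero.infinite k
  constructor
  · intro hfull χ hχ F hF hFv
    by_contra hF0
    have h := orbitMultiplicity_extend_add_finrank_eq_plethysmCoeff hι hup hf hf0 hm χ
    rw [hfull χ hχ] at h
    haveI : FiniteDimensional k ↥(highestWeightSpace (coordRep σ k m) χ) :=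
      finiteDimensional_highestWeightSpace_coordRep_holds hm χ
    haveI : Module.Finite k ↥(highestWeightSpace (coordRep σ k m) χ ⊓
        (MvPolynomial.vanishingIdeal k
          (formCoeff m '' {p : MvPolynomial σ k | rename ι p ∈ orbitClosure f})).restrictScalars k) :=
      Module.Finite.of_injective (Submodule.inclusion inf_le_left) (Submodule.inclusion_injective _)
    have hbot : highestWeightSpace (coordRep σ k m) χ ⊓
        (MvPolynomial.vanishingIdeal k
          (formCoeff m '' {p : MvPolynomial σ k | rename ι p ∈ orbitClosure f})).restrictScalars k =
        ⊥ := Submodule.finrank_eq_zero.mp (by omega)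
    refine hF0 ((Submodule.eq_bot_iff _).mp hbot F (Submodule.mem_inf.mpr ⟨hF, ?_⟩))
    rw [Submodule.restrictScalars_mem, MvPolynomial.mem_vanishingIdeal_iff, Set.forall_mem_image]
    exact fun p hp => hFv p hp
  · intro hno χ hχ
    by_contra hne
    have hlt : orbitMultiplicity k f m (Function.extend ι χ 0) < plethysmCoeff k σ m χ := by
      have h := orbitMultiplicity_extend_add_finrank_eq_plethysmCoeff hι hup hf hf0 hm χ
      omega
    obtain ⟨F, hF, hF0, -, hFv⟩ := exists_hwv_of_orbitMultiplicity_extend_lt hι hup hf hf0 hm χ hχ hlt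
    exact hF0 (hno χ hχ F hF hFv)

/-! ### §8 The `σ`-letter part is `GL_σ`-stable: plain equations versus highest-weight
equations -/

/-- **The `σ`-letter part of `Δ_m(f)` is `GL_σ`-stable**: if `ι p ∈ Δ_m(f)` then
`ι (g · p) = ext(g) · ι p ∈ Δ_m(f)` for every `g ∈ GL_σ` (`ext(g) ∈ GL_τ` the block-diagonal
extension, `linSubst_extendMatrix_rename`; orbit closures are `GL`-stable and transitive).
[folklore] -/
theorem rename_linSubstRep_mem_orbitClosure (hι : Function.Injective ι) {f : MvPolynomial τ k}
    (g : GL σ k) {p : MvPolynomial σ k} (hp : rename ι p ∈ orbitClosure f) :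
    rename ι (linSubstRep σ k g p) ∈ orbitClosure f := by
  rw [linSubstRep_apply, ← linSubst_extendMatrix_rename hι, ← coe_extendGL hι,
    ← linSubstRep_apply]
  exact orbitClosure_subset_of_mem_holds hp (glOrbit_subset_orbitClosure _ ⟨extendGL k hι g, rfl⟩)

/-- **An equation of the `σ`-letter part in degree `D` yields a HIGHEST-WEIGHT equation in degree
`D`** (infinite field): the forms of degree `D` on `Sym^m k^σ` vanishing on the `σ`-letter part
of `Δ_m(f)` form a finite-dimensional `GL_σ`-stable subspace of the rational representation
`k[Sym^m k^σ]` (`aeval_formCoeff_coordSubst`, `rename_linSubstRep_mem_orbitClosure`), so a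
nonzero one produces a nonzero highest-weight vector there (Lie–Kolchin,
`exists_hasHighestWeight_of_isRationalRep`; cf. `exists_hwv_of_mem_orbitVanishingIdeal` for the
ideal of one orbit). [cite: BurgisserIkenmeyer2013, §3.3 Prop. 3.3 (proof)] -/
theorem exists_hwv_of_isHomogeneous_of_forall_orbitClosure [Infinite k]
    (hι : Function.Injective ι) {f : MvPolynomial τ k} {D : ℕ}
    {Ψ : MvPolynomial (DegIdx σ m) k} (hΨd : Ψ.IsHomogeneous D) (hΨ0 : Ψ ≠ 0)
    (hΨv : ∀ p : MvPolynomial σ k, rename ι p ∈ orbitClosure f → aeval (formCoeff m p) Ψ = 0) :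
    ∃ (χ : Weight σ) (F : MvPolynomial (DegIdx σ m) k),
      F ∈ highestWeightSpace (coordRep σ k m) χ ∧ F ≠ 0 ∧ F.IsHomogeneous D ∧
        ∀ p : MvPolynomial σ k, rename ι p ∈ orbitClosure f → aeval (formCoeff m p) F = 0 := by
  classical
  -- the stable subspace `W = k[Sym^m k^σ]_D ∩ I(σ-letter part)`
  let J : Ideal (MvPolynomial (DegIdx σ m) k) :=
    MvPolynomial.vanishingIdeal k
      (formCoeff m '' {p : MvPolynomial σ k | rename ι p ∈ orbitClosure f})
  have hJ : ∀ F : MvPolynomial (DegIdx σ m) k, F ∈ J ↔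
      ∀ p : MvPolynomial σ k, rename ι p ∈ orbitClosure f → aeval (formCoeff m p) F = 0 := by
    intro F
    rw [MvPolynomial.mem_vanishingIdeal_iff, Set.forall_mem_image]
    rfl
  let W : Submodule k (MvPolynomial (DegIdx σ m) k) :=
    homogeneousSubmodule (DegIdx σ m) k D ⊓ J.restrictScalars k
  have hWstab : ∀ (g : GL σ k) (v : MvPolynomial (DegIdx σ m) k), v ∈ W →
      coordRep σ k m g v ∈ W := by
    intro g v hv
    refine ⟨?_, ?_⟩
    · have h1 : v.IsHomogeneous D := (mem_homogeneousSubmodule D v).mp hv.1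
      change coordRep σ k m g v ∈ homogeneousSubmodule (DegIdx σ m) k D
      rw [mem_homogeneousSubmodule, coordRep_apply]
      exact isHomogeneous_coordSubst g h1
    · have h2 : v ∈ J := hv.2
      change coordRep σ k m g v ∈ J
      rw [coordRep_apply, hJ]
      intro p hp
      rw [aeval_formCoeff_coordSubst]
      exact (hJ v).mp h2 _ (rename_linSubstRep_mem_orbitClosure hι g⁻¹ hp)
  let V₁ : Subrepresentation (coordRep σ k m) := ⟨W, fun g _ hv => hWstab g _ hv⟩
  haveI : Module.Finite k ↥(homogeneousSubmodule (DegIdx σ m) k D) :=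
    finite_homogeneousSubmodule _ _ _
  haveI : Module.Finite k ↥V₁.toSubmodule :=
    Module.Finite.of_injective (Submodule.inclusion (inf_le_left : W ≤ _))
      (Submodule.inclusion_injective _)
  have hΨW : Ψ ∈ V₁.toSubmodule := ⟨(mem_homogeneousSubmodule D Ψ).mpr hΨd, (hJ Ψ).mpr hΨv⟩
  haveI : Nontrivial ↥V₁.toSubmodule :=
    ⟨⟨⟨Ψ, hΨW⟩, 0, fun h => hΨ0 (congrArg Subtype.val h)⟩⟩
  have hρ₁ : IsRationalRep V₁.toRepresentation := (isRationalRep_coordRep m).toRepresentation V₁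
  obtain ⟨χ, hχ⟩ := exists_hasHighestWeight_of_isRationalRep V₁.toRepresentation hρ₁
  obtain ⟨v, hv0, hv⟩ := (hasHighestWeight_iff_exists _ _).mp hχ
  refine ⟨χ, (v : MvPolynomial (DegIdx σ m) k),
    (mem_highestWeightSpace_toRepresentation_iff V₁ χ v).mp hv, ?_, ?_, (hJ _).mp v.2.2⟩
  · exact fun h => hv0 (Subtype.ext h)
  · exact (mem_homogeneousSubmodule D _).mp v.2.1

omit [Fintype τ] [LinearOrder τ] in
/-- A weight pins the degree, converse direction (universe-polymorphic copy of the tree's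
`size_eq_of_mem_weightSpace_of_isHomogeneous`): a nonzero weight vector of `k[Sym^m k^σ]` of
weight `χ` that is homogeneous of degree `D` has `|χ| = -m D`. [cite: BurgisserEtAl2011, §4.4] -/
theorem size_eq_of_mem_weightSpace_of_isHomogeneous_of_ne_zero [Infinite k]
    {χ : Weight σ} {F : MvPolynomial (DegIdx σ m) k} (hF : F ∈ weightSpace (coordRep σ k m) χ)
    (hF0 : F ≠ 0) {D : ℕ} (hFD : F.IsHomogeneous D) : χ.size = -((m * D : ℕ) : ℤ) := by
  obtain ⟨s, hs⟩ : ∃ s, s ∈ F.support := Finset.nonempty_iff_ne_empty.mpr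
    (fun h => hF0 (MvPolynomial.support_eq_empty.mp h))
  have hw := monWeight_eq_of_mem_weightSpace hF hs
  have hsize := size_monWeight s
  have hdeg : s.degree = D := by
    have := hFD (mem_support_iff.mp hs)
    rwa [Finsupp.degree_eq_weight_one]
  rw [← hw, hsize, hdeg]

/-- **Few-row fullness in degree `D` ⇔ no few-letter equation of degree `D`.** For `f` a nonzero
form of degree `m ≠ 0` (characteristic zero) and `ι : σ → τ` strictly monotone onto an upper set:
ALL few-row types `χ̂` of degree `D` (`|χ| = -m D`) are full in `k[Δ_m(f)]` if and only if NO
nonzero form of degree `D` on `Sym^m k^σ` vanishes on the `σ`-letter part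
`{p ∈ k[x_σ] : ι p ∈ Δ_m(f)}`. (So when that part is an irreducible hypersurface of degree `N₀`,
e.g. `N₀ = 320 112` for `det₄` on four letters [Leal–Lozano Huerta–Vite 2024, Thm. 2], the
few-row types of degree `D` are all full exactly when `D < N₀`.) [cite: BurgisserEtAl2011, Prop. 6.3.2; §4.4] -/
theorem forall_orbitMultiplicity_extend_eq_iff_forall_isHomogeneous_eq_zero [CharZero k]
    (hι : StrictMono ι) (hup : IsUpperSet (Set.range ι)) {f : MvPolynomial τ k}
    (hf : f.IsHomogeneous m) (hf0 : f ≠ 0) (hm : m ≠ 0) (D : ℕ) :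
    (∀ χ : Weight σ, χ.size = -((m * D : ℕ) : ℤ) →
        orbitMultiplicity k f m (Function.extend ι χ 0) = plethysmCoeff k σ m χ) ↔
      ∀ F : MvPolynomial (DegIdx σ m) k, F.IsHomogeneous D →
        (∀ p : MvPolynomial σ k, rename ι p ∈ orbitClosure f → aeval (formCoeff m p) F = 0) →
          F = 0 := by
  haveI : Infinite k := CharZero.infinite k
  constructor
  · intro hfull F hFD hFv
    by_contra hF0
    obtain ⟨χ, G, hG, hG0, hGD, hGv⟩ :=
      exists_hwv_of_isHomogeneous_of_forall_orbitClosure hι.injective hFD hF0 hFv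
    have hχ : χ.size = -((m * D : ℕ) : ℤ) :=
      size_eq_of_mem_weightSpace_of_isHomogeneous_of_ne_zero
        (highestWeightSpace_le_weightSpace _ _ hG) hG0 hGD
    exact hG0 ((forall_orbitMultiplicity_extend_eq_iff_forall_hwv_eq_zero hι hup hf hf0 hm D).mp
      hfull χ hχ G hG hGv)
  · intro hno χ hχ
    exact orbitMultiplicity_extend_eq_plethysmCoeff_of_forall_isHomogeneous_eq_zero hι hup hf hf0
      hm hno χ hχ

/-! ### §9 Partition form of the degree-wise criterion (any placement); the determinant -/

/-- **All types `λ` with `ℓ(λ) ≤ K` and `|λ| = m D` are full in `k[Δ_m(f)]` ⇔ the `K`-letter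
part of `Δ_m(f)` has no equation of degree `D`** — partition form of
`forall_orbitMultiplicity_extend_eq_iff_forall_isHomogeneous_eq_zero` for an arbitrary injective
placement `κ : Fin K → τ ≃o Fin N` of the `K` letters (characteristic zero, `m ≠ 0`, `f` a nonzero
form of degree `m`; the multiplicity of `λ^*` is then the small plethysm coefficient
`a_λ(m, K)`). Weights of `GL_K` that are not of the form `λ^*` carry no highest-weight vector of
`k[Sym^m k^K]` (`exists_eq_dualOfPartition_of_hasHighestWeight_coordRep_holds`) and are
trivially full. [cite: BurgisserEtAl2011, Prop. 6.3.2; §4.4] -/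
theorem forall_orbitMultiplicity_dualOfPartition_eq_iff_forall_isHomogeneous_eq_zero [CharZero k]
    {K N : ℕ} (e : Fin N ≃o τ) (κ : Fin K → τ) (hκ : Function.Injective κ) {f : MvPolynomial τ k}
    (hf : f.IsHomogeneous m) (hf0 : f ≠ 0) (hm : m ≠ 0) (D : ℕ) :
    (∀ ⦃n : ℕ⦄ (lam : Nat.Partition n), lam.parts.card ≤ K → n = m * D →
        orbitMultiplicity k f m (fun x => Weight.dualOfPartition N lam (e.symm x)) =
          plethysmCoeffOfPartition k K m lam) ↔
      ∀ F : MvPolynomial (DegIdx (Fin K) m) k, F.IsHomogeneous D →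
        (∀ p : MvPolynomial (Fin K) k, rename κ p ∈ orbitClosure f → aeval (formCoeff m p) F = 0) →
          F = 0 := by
  haveI : Infinite k := CharZero.infinite k
  have hKN : K ≤ N := by
    have := Fintype.card_le_of_injective κ hκ
    rwa [Fintype.card_fin, ← Fintype.card_congr e.toEquiv, Fintype.card_fin] at this
  obtain ⟨hsm, hup⟩ := strictMono_comp_topEmb e hKN
  have key :=
    forall_orbitMultiplicity_extend_eq_iff_forall_isHomogeneous_eq_zero hsm hup hf hf0 hm D
  -- the two placements have the same few-letter part
  have hpart : ∀ p : MvPolynomial (Fin K) k,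
      rename (fun i => e (topEmb hKN i)) p ∈ orbitClosure f ↔ rename κ p ∈ orbitClosure f :=
    fun p => ⟨rename_mem_orbitClosure_of_rename_mem_orbitClosure _ κ hsm.injective hκ,
      rename_mem_orbitClosure_of_rename_mem_orbitClosure κ _ hκ hsm.injective⟩
  simp only [hpart] at key
  rw [← key]
  constructor
  · intro hfull χ hχ
    by_cases hHW : HasHighestWeight (coordRep (Fin K) k m) χ
    · obtain ⟨n, lam, hlamK, rfl⟩ :=
        exists_eq_dualOfPartition_of_hasHighestWeight_coordRep_holds hHW
      have hsize : (Weight.dualOfPartition K lam).size = -((n * m : ℕ) : ℤ) := by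
        rw [Weight.dualOfPartition, Weight.size_dual, Weight.size_ofPartition_holds hlamK]
      have hn : n * m = m * D := by
        rw [hsize] at hχ
        exact_mod_cast neg_injective hχ
      have h := hfull lam hlamK hn
      rwa [dualOfPartition_comp_symm_eq_extend e hKN lam hlamK] at h
    · -- no highest-weight vector of weight `χ` at all: both sides vanish
      have hbot : highestWeightSpace (coordRep (Fin K) k m) χ = ⊥ := by
        by_contra hne
        exact hHW hne
      have ha : plethysmCoeff k (Fin K) m χ = 0 := by
        change Module.finrank k ↥(highestWeightSpace (coordRep (Fin K) k m) χ) = 0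
        rw [hbot, finrank_bot]
      have h := orbitMultiplicity_extend_add_finrank_eq_plethysmCoeff hsm hup hf hf0 hm χ
      omega
  · intro hfull n lam hlamK hn
    have hsize : (Weight.dualOfPartition K lam).size = -((m * D : ℕ) : ℤ) := by
      rw [Weight.dualOfPartition, Weight.size_dual, Weight.size_ofPartition_holds hlamK, hn]
    rw [dualOfPartition_comp_symm_eq_extend e hKN lam hlamK]
    exact hfull _ hsize

section TypologyDegree

variable {k₀ : Type} [Field k₀] [CharZero k₀]

/-- **The determinant, degree by degree.** For `det_M` (`M ≠ 0`) and ANY injective placement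
`κ : Fin K → MatIdx M` of `K` of the matrix entries: all types `λ` with `ℓ(λ) ≤ K`, `|λ| = M D`
are full in `k[Ω_M]_D` (multiplicity `a_λ(M, K)`) iff no nonzero form of degree `D` on `K`-ary
`M`-ics vanishes on every `K`-ary `M`-ic lying (placed by `κ`) in `Ω_M`. For `M = K = 4` the
latter holds exactly for `D < 320 112` [Leal–Lozano Huerta–Vite 2024, Thm. 2: the linear
determinantal quartic surfaces form a prime divisor of degree `320 112`] — an input not proved
here. [cite: BurgisserEtAl2011, Prop. 6.3.2; §4.4] -/
theorem forall_orbitMultiplicity_detFormLex_eq_iff_forall_isHomogeneous_eq_zero {M K : ℕ}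
    (κ : Fin K → MatIdx M) (hκ : Function.Injective κ) (hM : M ≠ 0) (D : ℕ) :
    (∀ ⦃n : ℕ⦄ (lam : Nat.Partition n), lam.parts.card ≤ K → n = M * D →
        orbitMultiplicity k₀ (detFormLex k₀ M) M (Weight.dualOfPartition (M * M) lam).toMatIdx =
          plethysmCoeffOfPartition k₀ K M lam) ↔
      ∀ F : MvPolynomial (DegIdx (Fin K) M) k₀, F.IsHomogeneous D →
        (∀ p : MvPolynomial (Fin K) k₀, rename κ p ∈ orbitClosure (detFormLex k₀ M) →
          aeval (formCoeff M p) F = 0) → F = 0 :=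
  forall_orbitMultiplicity_dualOfPartition_eq_iff_forall_isHomogeneous_eq_zero (matIdxEquiv M) κ hκ
    (detFormLex_isHomogeneous k₀ M) (Literature.Computability.Complexity.detFormLex_ne_zero M) hM D

/-- … and in a degree `D` in which the `K`-letter part of `Ω_M` has no equation, **no type with
`ℓ(λ) ≤ K` is a multiplicity obstruction against `g ∈ Ω_M`** for any form `g` on the matrix
entries (e.g. the padded permanent). [cite: BurgisserEtAl2011, Prop. 6.3.2; §4.4] -/
theorem not_isMultiplicityObstructionAt_detFormLex_of_forall_isHomogeneous_eq_zero {M K : ℕ}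
    (κ : Fin K → MatIdx M) (hκ : Function.Injective κ) (hM : M ≠ 0) {D : ℕ}
    (hD : ∀ F : MvPolynomial (DegIdx (Fin K) M) k₀, F.IsHomogeneous D →
      (∀ p : MvPolynomial (Fin K) k₀, rename κ p ∈ orbitClosure (detFormLex k₀ M) →
        aeval (formCoeff M p) F = 0) → F = 0)
    (g : MvPolynomial (MatIdx M) k₀) {n : ℕ} (lam : Nat.Partition n) (hlam : lam.parts.card ≤ K)
    (hn : n = M * D) :
    ¬ IsMultiplicityObstructionAt (detFormLex k₀ M) g M
      (Weight.dualOfPartition (M * M) lam).toMatIdx := by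
  intro hlt
  have hfull := (forall_orbitMultiplicity_detFormLex_eq_iff_forall_isHomogeneous_eq_zero κ hκ hM
    D).mpr hD lam hlam hn
  have hKN : K ≤ M * M := by
    have := Fintype.card_le_of_injective κ hκ
    rwa [Fintype.card_fin, ← Fintype.card_congr (matIdxEquiv M).toEquiv, Fintype.card_fin] at this
  haveI : Infinite k₀ := CharZero.infinite k₀
  obtain ⟨hsm, hup⟩ := strictMono_comp_topEmb (matIdxEquiv M) hKN
  -- `mult(g) ≤ a_{λ*}(M, M²) = a_λ(M, K) = mult(det)`
  have hw : (Weight.dualOfPartition (M * M) lam).toMatIdx =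
      Function.extend (fun i => matIdxEquiv M (topEmb hKN i)) (Weight.dualOfPartition K lam) 0 :=
    dualOfPartition_comp_symm_eq_extend (matIdxEquiv M) hKN lam hlam
  have ha : plethysmCoeff k₀ (MatIdx M) M (Weight.dualOfPartition (M * M) lam).toMatIdx =
      plethysmCoeffOfPartition k₀ K M lam := by
    rw [hw, plethysmCoeff_extend hsm hup]
    rfl
  have hle := orbitMultiplicity_add_finrank_inf_eq_plethysmCoeff g hM
    (Weight.dualOfPartition (M * M) lam).toMatIdx
  unfold IsMultiplicityObstructionAt at hlt
  omega

end TypologyDegree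

/-! ### §10 Principal few-letter ideal: the first few-row drop is in the degree of the
generator -/

/-- **When the ideal of the `σ`-letter part is principal, the first few-row drop is in the degree
of its generator.** Let `f` be a nonzero form of degree `m ≠ 0` (characteristic zero), `ι : σ → τ`
strictly monotone onto an upper set (`σ` nonempty), and suppose the vanishing ideal of the
`σ`-letter part `{p ∈ k[x_σ] : ι p ∈ Δ_m(f)} ⊂ Sym^m k^σ` is generated by ONE form `Φ ≠ 0` of
degree `N₀`. Then ALL few-row types of degree `D` are full in `k[Δ_m(f)]` iff `D < N₀` (degrees
in the domain `k[Sym^m k^σ]`: a nonzero multiple of `Φ` has degree `≥ N₀`, and `x^{D-N₀} Φ` is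
an equation of every degree `D ≥ N₀`). Example of the hypothesis (an input NOT proved here):
`f = det₄`, four letters, `Φ` = the irreducible equation of the linear determinantal quartic
surfaces, `N₀ = 320 112` [Leal–Lozano Huerta–Vite 2024, Thm. 2] — so the first 4-row type of
`k[Ω₄]` to drop does so in degree exactly `320 112`.
[cite: BurgisserEtAl2011, Prop. 6.3.2; §4.4] -/
theorem forall_orbitMultiplicity_extend_eq_iff_lt_of_vanishingIdeal_eq_span [CharZero k]
    [Nonempty σ] (hι : StrictMono ι) (hup : IsUpperSet (Set.range ι)) {f : MvPolynomial τ k}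
    (hf : f.IsHomogeneous m) (hf0 : f ≠ 0) (hm : m ≠ 0) {Φ : MvPolynomial (DegIdx σ m) k}
    {N₀ : ℕ} (hΦ : Φ.IsHomogeneous N₀) (hΦ0 : Φ ≠ 0)
    (hI : MvPolynomial.vanishingIdeal k
        (formCoeff m '' {p : MvPolynomial σ k | rename ι p ∈ orbitClosure f}) = Ideal.span {Φ})
    (D : ℕ) :
    (∀ χ : Weight σ, χ.size = -((m * D : ℕ) : ℤ) →
        orbitMultiplicity k f m (Function.extend ι χ 0) = plethysmCoeff k σ m χ) ↔ D < N₀ := by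
  rw [forall_orbitMultiplicity_extend_eq_iff_forall_isHomogeneous_eq_zero hι hup hf hf0 hm D]
  -- vanishing on the few-letter part = divisibility by `Φ`
  have hmem : ∀ F : MvPolynomial (DegIdx σ m) k,
      (∀ p : MvPolynomial σ k, rename ι p ∈ orbitClosure f → aeval (formCoeff m p) F = 0) ↔
        ∃ a, a * Φ = F := by
    intro F
    rw [← Ideal.mem_span_singleton', ← hI, MvPolynomial.mem_vanishingIdeal_iff,
      Set.forall_mem_image]
    rfl
  constructor
  · intro h
    by_contra hD
    rw [not_lt] at hD
    obtain ⟨i⟩ := ‹Nonempty σ›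
    let d₀ : DegIdx σ m := ⟨Finsupp.single i m, mem_degMonomials_iff.mpr (by simp)⟩
    have hG : (X d₀ ^ (D - N₀) * Φ : MvPolynomial (DegIdx σ m) k).IsHomogeneous D := by
      have := (isHomogeneous_X_pow d₀ (D - N₀)).mul hΦ
      rwa [Nat.sub_add_cancel hD] at this
    have hne : (X d₀ ^ (D - N₀) * Φ : MvPolynomial (DegIdx σ m) k) ≠ 0 :=
      mul_ne_zero (pow_ne_zero _ (X_ne_zero d₀)) hΦ0
    exact hne (h _ hG ((hmem _).mpr ⟨X d₀ ^ (D - N₀), rfl⟩))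
  · intro hD F hFD hFv
    obtain ⟨a, rfl⟩ := (hmem _).mp hFv
    by_contra hne
    have ha : a ≠ 0 := fun h => hne (by rw [h, zero_mul])
    have hdeg := totalDegree_mul_of_isDomain ha hΦ0
    rw [hFD.totalDegree hne, hΦ.totalDegree hΦ0] at hdeg
    omega

/-! ### §11 The polynomial-identity test: few-row equations are the forms vanishing on all
`σ`-restricted endomorphism translates -/

/-- **Polynomial-identity form of the few-letter test** (infinite field): a test polynomial `F`
on `Sym^m k^σ`, renamed, is an equation of `Δ_m(f)` iff `F` vanishes at the `σ`-letter part
`kill_σ(A · f)` of EVERY endomorphism translate `A · f`, `A ∈ Mat_τ(k)` — a polynomial identity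
in the entries of `A` (no closure involved). For `f = det_m` and `|σ| = 4`: a polynomial on
quaternary `m`-ics is a 4-row equation of `Ω_m` iff it vanishes on `det M(x₁,…,x₄)` for every
`m × m` matrix `M` of linear forms in four variables. (`⇒`: the ideal of the orbit vanishes on the
endomorphism orbit, `aeval_formCoeff_linSubst_eq_zero_of_mem_orbitVanishingIdeal`; `⇐`:
invertible `A` suffice by definition.) [cite: BurgisserEtAl2011, Prop. 6.3.2 (proof)] -/
theorem rename_mem_orbitVanishingIdeal_iff_forall_matrix [Infinite k] (hι : Function.Injective ι)
    (f : MvPolynomial τ k) (F : MvPolynomial (DegIdx σ m) k) :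
    rename (degIdxMap hι) F ∈ orbitVanishingIdeal f m ↔
      ∀ A : Matrix τ τ k, aeval (formCoeff m (killCompl hι (linSubst τ k A f))) F = 0 := by
  constructor
  · intro h A
    rw [← aeval_formCoeff_rename_degIdxMap hι]
    exact aeval_formCoeff_linSubst_eq_zero_of_mem_orbitVanishingIdeal h A
  · intro h
    rw [mem_orbitVanishingIdeal_iff]
    intro g
    rw [aeval_formCoeff_rename_degIdxMap, linSubstRep_apply]
    exact h _

/-- Hence (with §2) **the three tests agree** for `f` a nonzero form of degree `m` over an
infinite field: `F` vanishes on the `σ`-letter part of the orbit CLOSURE iff it vanishes on the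
`σ`-letter parts of all ENDOMORPHISM translates iff (renamed) it lies in the ideal of the ORBIT.
[cite: BurgisserEtAl2011, Prop. 6.3.2 (proof)] -/
theorem forall_orbitClosure_iff_forall_matrix [Infinite k] (hι : Function.Injective ι)
    {f : MvPolynomial τ k} (hf : f.IsHomogeneous m) (hf0 : f ≠ 0)
    (F : MvPolynomial (DegIdx σ m) k) :
    (∀ p : MvPolynomial σ k, rename ι p ∈ orbitClosure f → aeval (formCoeff m p) F = 0) ↔
      ∀ A : Matrix τ τ k, aeval (formCoeff m (killCompl hι (linSubst τ k A f))) F = 0 := by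
  rw [← rename_mem_orbitVanishingIdeal_iff_forall_orbitClosure hι hf hf0,
    rename_mem_orbitVanishingIdeal_iff_forall_matrix hι]

/-! ### §12 The few-row null control `a ≤ sk` as a theorem modulo few-letter density -/

section NullControl

variable {k₀ : Type} [Field k₀] [CharZero k₀]

/-- **The few-row null control.** If every `K`-ary form of degree `M` (placed by an injective
`κ : Fin K → MatIdx M`) lies in `Ω_M`, then for every `λ ⊢ M d` with `ℓ(λ) ≤ K` the SMALL
plethysm coefficient is bounded by the rectangular symmetric Kronecker coefficient:
`a_λ(M, K) = mult_{λ^*} k[Ω_M] ≤ sk(λ, M × d)` (fullness §6 + BLMW's orbit bound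
`orbitMultiplicity_det_le_symKroneckerCoeffRect`). This is the inequality `a ≤ sk` that the
GCT cell's few-row NULL CONTROL checks on its tables (density inputs: `K ≤ 3`, all `M`, Dickson
1921; `K = 4`, `M ≤ 3`, Beauville 2000 — proved Summits-side, not here).
[cite: BurgisserEtAl2011, Prop. 6.3.2, §5.2 Prop. 5.2.1] -/
theorem plethysmCoeffOfPartition_le_symKroneckerCoeffRect_of_forall_mem_orbitClosure {M K d : ℕ}
    [NeZero M] (κ : Fin K → MatIdx M) (hκ : Function.Injective κ)
    (hall : ∀ p : MvPolynomial (Fin K) k₀, p.IsHomogeneous M →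
      rename κ p ∈ orbitClosure (detFormLex k₀ M))
    (lam : Nat.Partition (M * d)) (hlam : lam.parts.card ≤ K) :
    plethysmCoeffOfPartition k₀ K M lam ≤ symKroneckerCoeffRect k₀ M d lam := by
  have hKM : K ≤ M * M := by
    have := Fintype.card_le_of_injective κ hκ
    rwa [Fintype.card_fin, ← Fintype.card_congr (matIdxEquiv M).toEquiv, Fintype.card_fin] at this
  rw [← orbitMultiplicity_detFormLex_eq_of_forall_mem_orbitClosure κ hκ (NeZero.ne M) hall lam hlam]
  exact orbitMultiplicity_det_le_symKroneckerCoeffRect k₀ M lam (hlam.trans hKM)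

/-- Degree-wise form: if the `K`-letter part of `Ω_M` has no equation of degree `d`, then
`a_λ(M, K) ≤ sk(λ, M × d)` for every `λ ⊢ M d` with `ℓ(λ) ≤ K`.
[cite: BurgisserEtAl2011, Prop. 6.3.2, §5.2 Prop. 5.2.1] -/
theorem plethysmCoeffOfPartition_le_symKroneckerCoeffRect_of_forall_isHomogeneous_eq_zero
    {M K d : ℕ} [NeZero M] (κ : Fin K → MatIdx M) (hκ : Function.Injective κ)
    (hD : ∀ F : MvPolynomial (DegIdx (Fin K) M) k₀, F.IsHomogeneous d →
      (∀ p : MvPolynomial (Fin K) k₀, rename κ p ∈ orbitClosure (detFormLex k₀ M) →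
        aeval (formCoeff M p) F = 0) → F = 0)
    (lam : Nat.Partition (M * d)) (hlam : lam.parts.card ≤ K) :
    plethysmCoeffOfPartition k₀ K M lam ≤ symKroneckerCoeffRect k₀ M d lam := by
  have hKM : K ≤ M * M := by
    have := Fintype.card_le_of_injective κ hκ
    rwa [Fintype.card_fin, ← Fintype.card_congr (matIdxEquiv M).toEquiv, Fintype.card_fin] at this
  rw [← (forall_orbitMultiplicity_detFormLex_eq_iff_forall_isHomogeneous_eq_zero κ hκ (NeZero.ne M)
    d).mpr hD lam hlam rfl]
  exact orbitMultiplicity_det_le_symKroneckerCoeffRect k₀ M lam (hlam.trans hKM)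

end NullControl

end Literature.Computability.AlgebraicComplexity
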